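import Summits.CriticalPhenomena.PercolationContinuityZ3.Theorems.PercNearOneGluingAdditiveGluingK0SetReduction
import Summits.CriticalPhenomena.PercolationContinuityZ3.Theorems.PercNearOneGluingAdditiveGluingK0SetBeta
import Summits.CriticalPhenomena.PercolationContinuityZ3.Theorems.PercNearOneGluingAdditiveGluingOfK0Set3
import HarnessLib

/-!
# Crux `PercNearOneGluing.AdditiveGluing` (stmt-CriticalPhenomena-4576), line `tieline`: the crux from ONE set-level kernel (X_A)

Support file (`--supports stmt-CriticalPhenomena-4576`, helper; seat (d) exchange-certificate form, gen 12).  No definitions, no named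
facts, no sorries.

With (T) landed (`TieLine.stub_k0CovTransferQ_c9`), the pair kernel (K₀) is a theorem (`TieLine.k0_pair`) and the crux follows from the
set-gluing kernel (K₀-set) for `|S| ≥ 3` alone (`TieLine.additiveGluing_of_k0set3`).  By `K0SetReduction.k0set_of_XA_betaSet` and the glued-owner
covariance transfer `K0SetBeta.betaSet` (PROVED), (K₀-set) reduces to the residual set kernel

  (X_A)  `ρ·(μ(N)μ(a_o) − μ(NJ)μ(a_c)) ≤ [μ(N)μ(P^D_o) − μ(NJ)μ(P^D_c)] + [(μ(N) − μ(NJ))·μ(Γ_{s₀}) − (μ(N)μ(Γ_o) − μ(NJ)μ(Γ_c))]`,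
  `ρ = μ(D ∩ {s₀↔b}) / μ(D)` (`x/0 = 0`), `D = {s₀ ↮ R}`, `R = S ∖ {s₀}`, `a_x = D ∩ xR`, `P^D_x = D ∩ BR ∩ {x↮s₀}`, `Γ_y = {y↮b} ∩ yR ∩ BR`,
  `N = (cS)ᶜ`, `NJ = N ∩ {o↔c}` (notation of `…K0SetReduction.lean`),

stated below VERBATIM as the hypothesis `hXA` (same quantifier prefix as the registered stub `stub_k0set3_g2`).  THIS FILE:
* `stub_k0set3_of_XA` — (X_A) ⟹ the registered stub `stub_k0set3_g2` (its statement verbatim);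
* `additiveGluing_of_XA` — (X_A) ⟹ `AdditiveGluing`.
(X_A) is the exact residue of the pair chain at the set level: for `|R| = 1` it is the covariance transfer (α) weakened by the τ-order; in general it
asks that the split-attachment transfer `μ(N)μ(Γ_o) − μ(NJ)μ(Γ_c) − (μ(N)−μ(NJ))μ(Γ_{s₀})` be paid for by the owner-`s₀` transfer slack.  Evidence:
0 violations in the seat's exact censuses on graphs (n ≤ 7) AND on hypergraph percolation (memo K0SET-ANATOMY-g12.md §5; kit census j085079) —
the (T)/UCT signature; no proof is claimed here.
[cite: KozmaNitzan2024, Conjecture 1 (p. 3), Lemma 4 (p. 9), Question 7 (p. 36), §5.3 (p. 34)]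
[cite: VandenbergHaggstromKahn2005, Thms. 1.3–1.5 (pp. 6–8), §2.1 (pp. 9–13)] [cite: Gladkov2024, Thm. 3.2]
-/

namespace Summit.CriticalPhenomena.PercolationContinuityZ3.Cruxes.AdditiveGluing.TieLine

open MeasureTheory Set Literature.Probability.LatticeModels Literature.Probability.Percolation
open Summit.CriticalPhenomena.PercolationContinuityZ3.Theorems

noncomputable section
open Classical

/-- **(X_A) ⟹ (K₀-set) for `|S| ≥ 3`** (the registered stub `stub_k0set3_g2`, statement verbatim as the conclusion).  Per instance:
`K0SetBeta.betaSet` (glued-owner transfer, with `r₁ ∈ S ∖ {s₀}`, which is nonempty) gives `μ(N)μ(Q^D_o) − μ(NJ)μ(Q^D_c) ≤ ρ·Σ`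
(dividing by `μ(D)`; if `μ(D) = 0` both `Q^D`-measures vanish), and `K0SetReduction.k0set_of_XA_betaSet` concludes.
[cite: KozmaNitzan2024, Lemma 4 (p. 9), Question 7 (p. 36), §5.3 (p. 34)] -/
theorem stub_k0set3_of_XA
    (hXA : ∀ (n : ℕ) (w : Sym2 (Fin n) → unitInterval) (S : Finset (Fin n)) (o b c s₀ : Fin n), 3 ≤ S.card → s₀ ∈ S → c ∉ S →
      (∀ s ∈ S, (prodBernoulli w).real (openConn s₀ b) ≤ (prodBernoulli w).real (openConn s b)) →
      (prodBernoulli w).real ((⋃ r ∈ S.erase s₀, (openConn s₀ r : Set (BondConfig (Fin n))))ᶜ ∩ openConn s₀ b) /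
            (prodBernoulli w).real ((⋃ r ∈ S.erase s₀, (openConn s₀ r : Set (BondConfig (Fin n))))ᶜ) *
          ((prodBernoulli w).real ((⋃ s ∈ S, (openConn c s : Set (BondConfig (Fin n))))ᶜ) *
              (prodBernoulli w).real ((⋃ r ∈ S.erase s₀, (openConn s₀ r : Set (BondConfig (Fin n))))ᶜ ∩
                (⋃ r ∈ S.erase s₀, (openConn o r : Set (BondConfig (Fin n))))) -
            (prodBernoulli w).real ((⋃ s ∈ S, (openConn c s : Set (BondConfig (Fin n))))ᶜ ∩ openConn o c) *
              (prodBernoulli w).real ((⋃ r ∈ S.erase s₀, (openConn s₀ r : Set (BondConfig (Fin n))))ᶜ ∩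
                (⋃ r ∈ S.erase s₀, (openConn c r : Set (BondConfig (Fin n)))))) ≤
        ((prodBernoulli w).real ((⋃ s ∈ S, (openConn c s : Set (BondConfig (Fin n))))ᶜ) *
            (prodBernoulli w).real ((⋃ r ∈ S.erase s₀, (openConn s₀ r : Set (BondConfig (Fin n))))ᶜ ∩
              (⋃ r ∈ S.erase s₀, (openConn r b : Set (BondConfig (Fin n)))) ∩ (openConn o s₀)ᶜ) -
          (prodBernoulli w).real ((⋃ s ∈ S, (openConn c s : Set (BondConfig (Fin n))))ᶜ ∩ openConn o c) *
            (prodBernoulli w).real ((⋃ r ∈ S.erase s₀, (openConn s₀ r : Set (BondConfig (Fin n))))ᶜ ∩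
              (⋃ r ∈ S.erase s₀, (openConn r b : Set (BondConfig (Fin n)))) ∩ (openConn c s₀)ᶜ)) +
        (((prodBernoulli w).real ((⋃ s ∈ S, (openConn c s : Set (BondConfig (Fin n))))ᶜ) -
            (prodBernoulli w).real ((⋃ s ∈ S, (openConn c s : Set (BondConfig (Fin n))))ᶜ ∩ openConn o c)) *
            (prodBernoulli w).real ((openConn s₀ b)ᶜ ∩ (⋃ r ∈ S.erase s₀, (openConn s₀ r : Set (BondConfig (Fin n)))) ∩
              (⋃ r ∈ S.erase s₀, (openConn r b : Set (BondConfig (Fin n))))) -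
          ((prodBernoulli w).real ((⋃ s ∈ S, (openConn c s : Set (BondConfig (Fin n))))ᶜ) *
              (prodBernoulli w).real ((openConn o b)ᶜ ∩ (⋃ r ∈ S.erase s₀, (openConn o r : Set (BondConfig (Fin n)))) ∩
                (⋃ r ∈ S.erase s₀, (openConn r b : Set (BondConfig (Fin n))))) -
            (prodBernoulli w).real ((⋃ s ∈ S, (openConn c s : Set (BondConfig (Fin n))))ᶜ ∩ openConn o c) *
              (prodBernoulli w).real ((openConn c b)ᶜ ∩ (⋃ r ∈ S.erase s₀, (openConn c r : Set (BondConfig (Fin n)))) ∩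
                (⋃ r ∈ S.erase s₀, (openConn r b : Set (BondConfig (Fin n)))))))) :
    ∀ (n : ℕ) (w : Sym2 (Fin n) → unitInterval) (S : Finset (Fin n)) (o b c s₀ : Fin n), 3 ≤ S.card → s₀ ∈ S → c ∉ S →
      (∀ s ∈ S, (prodBernoulli w).real (openConn s₀ b) ≤ (prodBernoulli w).real (openConn s b)) →
      (prodBernoulli w).real ((⋃ s ∈ S, (openConn c s : Set (BondConfig (Fin n))))ᶜ ∩ openConn o c) *
          ((prodBernoulli w).real (⋃ s ∈ S, (openConn s b : Set (BondConfig (Fin n)))) -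
            (prodBernoulli w).real (openConn s₀ b) -
            (prodBernoulli w).real ((openConn c b)ᶜ ∩ (⋃ s ∈ S, (openConn c s : Set (BondConfig (Fin n)))) ∩
              (⋃ s ∈ S, (openConn s b : Set (BondConfig (Fin n)))))) ≤
        (prodBernoulli w).real ((⋃ s ∈ S, (openConn c s : Set (BondConfig (Fin n))))ᶜ) *
          ((prodBernoulli w).real (⋃ s ∈ S, (openConn s b : Set (BondConfig (Fin n)))) -
            (prodBernoulli w).real (openConn s₀ b) -
            (prodBernoulli w).real ((openConn o b)ᶜ ∩ (⋃ s ∈ S, (openConn o s : Set (BondConfig (Fin n)))) ∩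
              (⋃ s ∈ S, (openConn s b : Set (BondConfig (Fin n)))))) := by
  intro n w S o b c s₀ h3 hs₀ hc hmin
  -- a second relay `r₁ ∈ R = S ∖ {s₀}`
  have hRne : (S.erase s₀).Nonempty := by
    rw [← Finset.card_pos, Finset.card_erase_of_mem hs₀]; omega
  obtain ⟨r₁, hr₁⟩ := hRne
  -- (β-set) in the glued form, `N` written with `insert s₀ (S.erase s₀) = S`
  have hβ0 := K0SetBeta.betaSet w (S.erase s₀) hr₁ s₀ o c b
  rw [Finset.insert_erase hs₀] at hβ0
  -- abbreviations
  set d := (prodBernoulli w).real ((⋃ r ∈ S.erase s₀, (openConn s₀ r : Set (BondConfig (Fin n))))ᶜ) with hd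
  set db := (prodBernoulli w).real ((⋃ r ∈ S.erase s₀, (openConn s₀ r : Set (BondConfig (Fin n))))ᶜ ∩ openConn s₀ b) with hdb
  set N := (prodBernoulli w).real ((⋃ s ∈ S, (openConn c s : Set (BondConfig (Fin n))))ᶜ) with hN
  set NJ := (prodBernoulli w).real ((⋃ s ∈ S, (openConn c s : Set (BondConfig (Fin n))))ᶜ ∩ openConn o c) with hNJ
  set ao := (prodBernoulli w).real ((⋃ r ∈ S.erase s₀, (openConn s₀ r : Set (BondConfig (Fin n))))ᶜ ∩
    (⋃ r ∈ S.erase s₀, (openConn o r : Set (BondConfig (Fin n))))) with hao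
  set ac := (prodBernoulli w).real ((⋃ r ∈ S.erase s₀, (openConn s₀ r : Set (BondConfig (Fin n))))ᶜ ∩
    (⋃ r ∈ S.erase s₀, (openConn c r : Set (BondConfig (Fin n))))) with hac
  set Qo := (prodBernoulli w).real ((⋃ r ∈ S.erase s₀, (openConn s₀ r : Set (BondConfig (Fin n))))ᶜ ∩ openConn s₀ b ∩
    (⋃ r ∈ S.erase s₀, (openConn o r : Set (BondConfig (Fin n))))) with hQo
  set Qc := (prodBernoulli w).real ((⋃ r ∈ S.erase s₀, (openConn s₀ r : Set (BondConfig (Fin n))))ᶜ ∩ openConn s₀ b ∩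
    (⋃ r ∈ S.erase s₀, (openConn c r : Set (BondConfig (Fin n))))) with hQc
  -- (β-set) divided by `μ(D)`
  have hβ : N * Qo - NJ * Qc ≤ db / d * (N * ao - NJ * ac) := by
    change d * (Qo * N - Qc * NJ) ≤ db * (ao * N - ac * NJ) at hβ0
    rcases (measureReal_nonneg : 0 ≤ d).eq_or_lt with h0 | hpos
    · -- `μ(D) = 0`: the `Q^D`-measures vanish
      have hQo0 : Qo = 0 := le_antisymm (by
        rw [h0]; exact measureReal_mono (inter_subset_left.trans inter_subset_left) (measure_ne_top _ _)) measureReal_nonneg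
      have hQc0 : Qc = 0 := le_antisymm (by
        rw [h0]; exact measureReal_mono (inter_subset_left.trans inter_subset_left) (measure_ne_top _ _)) measureReal_nonneg
      have hd0 : d = 0 := h0.symm
      rw [hQo0, hQc0, hd0, div_zero]
      simp
    · rw [div_mul_eq_mul_div, le_div_iff₀ hpos]
      linarith
  exact K0SetReduction.k0set_of_XA_betaSet w S o b c s₀ hs₀ (db / d * (N * ao - NJ * ac)) hβ (hXA n w S o b c s₀ h3 hs₀ hc hmin)

/-- **`AdditiveGluing` from the single set-level kernel (X_A)** (hypothesis verbatim as in `stub_k0set3_of_XA`):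
`additiveGluing_of_k0set3 (stub_k0set3_of_XA hXA)`. [cite: KozmaNitzan2024, Conjecture 1 (p. 3), §5.3 (p. 34)] -/
theorem additiveGluing_of_XA
    (hXA : ∀ (n : ℕ) (w : Sym2 (Fin n) → unitInterval) (S : Finset (Fin n)) (o b c s₀ : Fin n), 3 ≤ S.card → s₀ ∈ S → c ∉ S →
      (∀ s ∈ S, (prodBernoulli w).real (openConn s₀ b) ≤ (prodBernoulli w).real (openConn s b)) →
      (prodBernoulli w).real ((⋃ r ∈ S.erase s₀, (openConn s₀ r : Set (BondConfig (Fin n))))ᶜ ∩ openConn s₀ b) /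
            (prodBernoulli w).real ((⋃ r ∈ S.erase s₀, (openConn s₀ r : Set (BondConfig (Fin n))))ᶜ) *
          ((prodBernoulli w).real ((⋃ s ∈ S, (openConn c s : Set (BondConfig (Fin n))))ᶜ) *
              (prodBernoulli w).real ((⋃ r ∈ S.erase s₀, (openConn s₀ r : Set (BondConfig (Fin n))))ᶜ ∩
                (⋃ r ∈ S.erase s₀, (openConn o r : Set (BondConfig (Fin n))))) -
            (prodBernoulli w).real ((⋃ s ∈ S, (openConn c s : Set (BondConfig (Fin n))))ᶜ ∩ openConn o c) *
              (prodBernoulli w).real ((⋃ r ∈ S.erase s₀, (openConn s₀ r : Set (BondConfig (Fin n))))ᶜ ∩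
                (⋃ r ∈ S.erase s₀, (openConn c r : Set (BondConfig (Fin n)))))) ≤
        ((prodBernoulli w).real ((⋃ s ∈ S, (openConn c s : Set (BondConfig (Fin n))))ᶜ) *
            (prodBernoulli w).real ((⋃ r ∈ S.erase s₀, (openConn s₀ r : Set (BondConfig (Fin n))))ᶜ ∩
              (⋃ r ∈ S.erase s₀, (openConn r b : Set (BondConfig (Fin n)))) ∩ (openConn o s₀)ᶜ) -
          (prodBernoulli w).real ((⋃ s ∈ S, (openConn c s : Set (BondConfig (Fin n))))ᶜ ∩ openConn o c) *
            (prodBernoulli w).real ((⋃ r ∈ S.erase s₀, (openConn s₀ r : Set (BondConfig (Fin n))))ᶜ ∩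
              (⋃ r ∈ S.erase s₀, (openConn r b : Set (BondConfig (Fin n)))) ∩ (openConn c s₀)ᶜ)) +
        (((prodBernoulli w).real ((⋃ s ∈ S, (openConn c s : Set (BondConfig (Fin n))))ᶜ) -
            (prodBernoulli w).real ((⋃ s ∈ S, (openConn c s : Set (BondConfig (Fin n))))ᶜ ∩ openConn o c)) *
            (prodBernoulli w).real ((openConn s₀ b)ᶜ ∩ (⋃ r ∈ S.erase s₀, (openConn s₀ r : Set (BondConfig (Fin n)))) ∩
              (⋃ r ∈ S.erase s₀, (openConn r b : Set (BondConfig (Fin n))))) -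
          ((prodBernoulli w).real ((⋃ s ∈ S, (openConn c s : Set (BondConfig (Fin n))))ᶜ) *
              (prodBernoulli w).real ((openConn o b)ᶜ ∩ (⋃ r ∈ S.erase s₀, (openConn o r : Set (BondConfig (Fin n)))) ∩
                (⋃ r ∈ S.erase s₀, (openConn r b : Set (BondConfig (Fin n))))) -
            (prodBernoulli w).real ((⋃ s ∈ S, (openConn c s : Set (BondConfig (Fin n))))ᶜ ∩ openConn o c) *
              (prodBernoulli w).real ((openConn c b)ᶜ ∩ (⋃ r ∈ S.erase s₀, (openConn c r : Set (BondConfig (Fin n)))) ∩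
                (⋃ r ∈ S.erase s₀, (openConn r b : Set (BondConfig (Fin n)))))))) :
    Summit.CriticalPhenomena.PercolationContinuityZ3.Theses.PercNearOneGluing.AdditiveGluing :=
  additiveGluing_of_k0set3 (stub_k0set3_of_XA hXA)

end

end Summit.CriticalPhenomena.PercolationContinuityZ3.Cruxes.AdditiveGluing.TieLine
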